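import Summits.CriticalPhenomena.PercolationContinuityZ3.Theorems.Transplant.AutChartCylinders
import HarnessLib

/-!
# The chart datum of an action by automorphisms with FINITELY MANY ORBITS (stabilisers arbitrary), I: the zero-offset equivariant chart on a
# transversal, exact steps at every vertex, boxed walks, kernel walks

builds on p205010 (kernel theorem, internal audit signed; external expert review pending) — nothing in this file uses p205010; nothing here is a claim
about any open node.  Lane `prim-bschramm`, seat `prim-bschramm-p3` gen 28 (design owner; NEXT-SCOPE (N3): the action / orbit side of the next rung —
groups and actions that reach `ℤ²` with finitely many vertex orbits).  Helper file (`--supports stmt-CriticalPhenomena-4575 --as helper`).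
DEFINITIONS + their immediate API; (κ′) and the skeleton are the sequel «AutChartOrbitsCylinders», the percolation theorem «AutChartOrbitsCriticalContinuity».

p4 gen 25's «AutChartDatum» / «AutChartCylinders» type the chart datum of a TRANSITIVE action (`ChartDatum G A t`: one orbit, chart `ψ ∘ sec`, one
base type `{t}`).  This file is the same construction for an action with FINITELY MANY ORBITS, read on a TRANSVERSAL `reps` of the orbits:
* **`AutChart.OrbitDatum G A`**: `A` acts by automorphisms on the connected graph `G`; `reps : Finset V` meets every orbit exactly once (`cover`,
  `trans`); an additive `ψ : A → ℤ²` killing EVERY vertex stabiliser; a scale `N ≥ 1` with `‖ψ a‖_∞ ≤ N` whenever `r ∼ a • r'` (`r, r' ∈ reps`) and,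
  at every representative, four neighbours `a • r'` with `ψ a = ± N eᵢ` EXACTLY (single-edge axis steps — the carriers' field; they do NOT follow from
  a rank-two character when there are several orbits, gen-1 g3 bus 2026-08-27 #5822 / this seat's design line); and a displacement bound `m` such that
  `ker ψ` is generated, for every base `r ∈ reps`, by kernel elements moving `r` by at most `m` (the relative Milnor kernel lemma supplies it off
  exponential growth — in the sequel);
* the type `typ w ∈ reps` and section `sec w` of a vertex (`sec w • typ w = w`; `typ` is `A`-invariant because `reps` is a transversal), and the
  ZERO-OFFSET chart `φ w := ψ (sec w)`: `φ (a • w) = ψ a + φ w`, `φ = 0` on `reps` (so the base types are CHART-ALIGNED), `N`-Lipschitz along edges,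
  exact `± N eᵢ` steps along single edges at every vertex;
* boxed walks `InBox R u v` (translation, concatenation, the `N ℓ` bound along walks of length `ℓ`) and **kernel walks** (`ker_inBox`: every
  `k ∈ ker ψ` moves a representative inside the box of radius `N m`).
Sequel «AutChartOrbitsCylinders»: coordinate reduction, (κ′) at every base from `ℓ₀` on, and the multi-type scaled skeleton `OrbitDatum.skeleton`
(`types = reps`, `L = N`, chart-aligned base types); «AutChartOrbitsCriticalContinuity»: the datum EXISTS off exponential growth and `θ_v(p_c) = 0`.
[cite: BenjaminiSchramm1996, §2 (almost transitive graphs); Conj. 4] [cite: KozmaNitzan2024, §4 pp. 15–16 (boxes; Lemma 8)] [cite: MartineauTassion2017, §3.2]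
[cite: MilnorSolvableGrowth1968, Lemma 1]
-/

noncomputable section

namespace Summit.CriticalPhenomena.PercolationContinuityZ3.Theorems.Transplant

open SimpleGraph Filter Literature.Barriers.CriticalPhenomena Literature.Probability.LatticeModels Literature.Probability.Percolation
open scoped Classical

namespace AutChart

variable {V : Type} {G : SimpleGraph V} {A : Type} [Group A] [MulAction A V]

/-! ## Transversals: the type and the section of a vertex -/

section Transversal

variable {reps : Finset V} (hcover : ∀ w : V, ∃ a : A, ∃ r ∈ reps, a • r = w)

/-- The section of a vertex with respect to a covering family of representatives: `osec w • otyp w = w`. [folklore] -/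
def osec (w : V) : A := Classical.choose (hcover w)

/-- The type (representative) of a vertex: `osec w • otyp w = w`, `otyp w ∈ reps`. [folklore] -/
def otyp (w : V) : V := Classical.choose (Classical.choose_spec (hcover w))

/-- `otyp w ∈ reps`. [folklore] -/
theorem otyp_mem (w : V) : otyp hcover w ∈ reps := (Classical.choose_spec (Classical.choose_spec (hcover w))).1

/-- `osec w • otyp w = w`. [folklore] -/
@[simp] theorem osec_smul (w : V) : osec hcover w • otyp hcover w = w := (Classical.choose_spec (Classical.choose_spec (hcover w))).2

/-- On a TRANSVERSAL the type of a representative is itself. [folklore] -/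
theorem otyp_of_mem (htrans : ∀ r ∈ reps, ∀ r' ∈ reps, ∀ a : A, a • r = r' → r = r') {r : V} (hr : r ∈ reps) : otyp hcover r = r :=
  htrans _ (otyp_mem hcover r) _ hr (osec hcover r) (osec_smul hcover r)

/-- On a transversal the type is `A`-INVARIANT: `otyp (a • w) = otyp w`. [folklore] -/
theorem otyp_smul (htrans : ∀ r ∈ reps, ∀ r' ∈ reps, ∀ a : A, a • r = r' → r = r') (a : A) (w : V) :
    otyp hcover (a • w) = otyp hcover w := by
  refine htrans _ (otyp_mem hcover _) _ (otyp_mem hcover _) ((a * osec hcover w)⁻¹ * osec hcover (a • w)) ?_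
  rw [mul_smul, osec_smul, inv_smul_eq_iff, mul_smul, osec_smul]

end Transversal

/-! ## The orbit datum -/

/-- **Orbit datum** for a group `A` acting by automorphisms on a connected graph with FINITELY MANY ORBITS, read on a transversal `reps`: an additive
`ψ : A → ℤ²` killing every stabiliser, a scale `N` bounding `‖ψ a‖_∞` on the elements carrying a representative next to a representative, EXACT single-edge
axis steps `± N eᵢ` at every representative, and a displacement bound `m` such that `ker ψ` is generated at every base by kernel elements moving it by at
most `m`.  (Produced by `exists_orbitDatum` in the sequel; consumed by `skeleton`.) [cite: KozmaNitzan2024, §4 p. 16 (Lemma 8)]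
[cite: BenjaminiSchramm1996, §2 (almost transitive graphs)] [cite: MilnorSolvableGrowth1968, Lemma 1] -/
structure OrbitDatum (G : SimpleGraph V) (A : Type) [Group A] [MulAction A V] where
  /-- the action is by graph automorphisms -/
  act : IsActionByAut G A
  /-- the graph is connected -/
  conn : G.Connected
  /-- the representatives -/
  reps : Finset V
  /-- every vertex is a translate of a representative -/
  cover : ∀ w : V, ∃ a : A, ∃ r ∈ reps, a • r = w
  /-- the representatives are pairwise inequivalent (a transversal) -/
  trans : ∀ r ∈ reps, ∀ r' ∈ reps, ∀ a : A, a • r = r' → r = r'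
  /-- the character -/
  ψ : A → Site 2
  /-- additivity -/
  ψ_mul : ∀ a b : A, ψ (a * b) = ψ a + ψ b
  /-- `ψ` kills EVERY vertex stabiliser -/
  ψ_stab : ∀ (v : V), ∀ h ∈ MulAction.stabilizer A v, ψ h = 0
  /-- the scale -/
  N : ℕ
  /-- the scale is positive -/
  one_le_N : 1 ≤ N
  /-- sup-norm `≤ N` on the elements carrying a representative next to a representative -/
  lipN : ∀ r ∈ reps, ∀ r' ∈ reps, ∀ a : A, G.Adj r (a • r') → ∀ i : Fin 2, |ψ a i| ≤ N
  /-- EXACT single-edge axis steps at every representative: a neighbour `a • r'` with `ψ a = N σ eᵢ` -/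
  step : ∀ r ∈ reps, ∀ (i : Fin 2) (σ : ℤˣ), ∃ (a : A) (r' : V), r' ∈ reps ∧ G.Adj r (a • r') ∧ ψ a = Pi.single i ((N : ℤ) * σ)
  /-- the kernel displacement bound -/
  m : ℕ
  /-- at every base `ker ψ` is generated by kernel elements moving the base by at most `m` -/
  ker_gen : ∀ r ∈ reps, ∀ k : A, ψ k = 0 → k ∈ Subgroup.closure {g : A | ψ g = 0 ∧ g • r ∈ graphBall G r m}

namespace OrbitDatum

/-- `ψ 1 = 0`. [folklore] -/
theorem ψ_one (D : OrbitDatum G A) : D.ψ 1 = 0 := by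
  have e := D.ψ_mul 1 1
  rw [one_mul] at e
  exact left_eq_add.1 e

/-- `ψ a⁻¹ = −ψ a`. [folklore] -/
theorem ψ_inv (D : OrbitDatum G A) (a : A) : D.ψ a⁻¹ = -D.ψ a := by
  have e := D.ψ_mul a⁻¹ a
  rw [inv_mul_cancel, D.ψ_one] at e
  exact eq_neg_of_add_eq_zero_left e.symm

/-- The section of a vertex: `sec w • typ w = w`. [folklore] -/
def sec (D : OrbitDatum G A) (w : V) : A := osec D.cover w

/-- The type of a vertex (its representative). [folklore] -/
def typ (D : OrbitDatum G A) (w : V) : V := otyp D.cover w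

/-- `typ w ∈ reps`. [folklore] -/
theorem typ_mem (D : OrbitDatum G A) (w : V) : D.typ w ∈ D.reps := otyp_mem D.cover w

/-- `sec w • typ w = w`. [folklore] -/
@[simp] theorem sec_smul (D : OrbitDatum G A) (w : V) : D.sec w • D.typ w = w := osec_smul D.cover w

/-- `typ r = r` on the transversal. [folklore] -/
theorem typ_of_mem (D : OrbitDatum G A) {r : V} (hr : r ∈ D.reps) : D.typ r = r := otyp_of_mem D.cover D.trans hr

/-- `typ (a • w) = typ w`. [folklore] -/
theorem typ_smul (D : OrbitDatum G A) (a : A) (w : V) : D.typ (a • w) = D.typ w := otyp_smul D.cover D.trans a w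

/-- `sec r` stabilises a representative `r`. [folklore] -/
theorem sec_mem_stabilizer (D : OrbitDatum G A) {r : V} (hr : r ∈ D.reps) : D.sec r ∈ MulAction.stabilizer A r := by
  rw [MulAction.mem_stabilizer_iff]
  have h := D.sec_smul r
  rwa [D.typ_of_mem hr] at h

/-! ### The zero-offset equivariant chart -/

/-- **The chart of `G`**: `φ w := ψ (sec w)` (offset zero on every representative). [folklore] -/
def chart (D : OrbitDatum G A) (w : V) : Site 2 := D.ψ (D.sec w)

/-- `φ w = ψ (sec w)`. [folklore] -/
theorem chart_eq (D : OrbitDatum G A) (w : V) : D.chart w = D.ψ (D.sec w) := rfl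

/-- **Equivariance**: `φ (a • w) = ψ a + φ w` (the type is `A`-invariant and `ψ` kills its stabiliser). [folklore] -/
theorem chart_smul (D : OrbitDatum G A) (a : A) (w : V) : D.chart (a • w) = D.ψ a + D.chart w := by
  unfold chart
  have h : ((D.sec (a • w))⁻¹ * (a * D.sec w)) • D.typ w = D.typ w := by
    rw [mul_smul, mul_smul, D.sec_smul, inv_smul_eq_iff, ← D.typ_smul a w, D.sec_smul]
  have h0 := D.ψ_stab _ _ (MulAction.mem_stabilizer_iff.2 h)
  rw [D.ψ_mul, D.ψ_mul, D.ψ_inv] at h0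
  exact neg_add_eq_zero.1 h0

/-- **`φ = 0` on the representatives.** [folklore] -/
theorem chart_of_mem (D : OrbitDatum G A) {r : V} (hr : r ∈ D.reps) : D.chart r = 0 := D.ψ_stab r _ (D.sec_mem_stabilizer hr)

/-- `φ (typ w) = 0`. [folklore] -/
theorem chart_typ (D : OrbitDatum G A) (w : V) : D.chart (D.typ w) = 0 := D.chart_of_mem (D.typ_mem w)

/-- `φ (a • r) = ψ a` for a representative `r`. [folklore] -/
theorem chart_smul_of_mem (D : OrbitDatum G A) (a : A) {r : V} (hr : r ∈ D.reps) : D.chart (a • r) = D.ψ a := by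
  rw [D.chart_smul, D.chart_of_mem hr, add_zero]

/-- **`φ` is `N`-Lipschitz along edges** (every edge is a translate of an edge at a representative). [folklore] -/
theorem chart_lip (D : OrbitDatum G A) {u v : V} (huv : G.Adj u v) (i : Fin 2) : |D.chart u i - D.chart v i| ≤ D.N := by
  set b := D.sec u with hb
  have hut : b⁻¹ • u = D.typ u := by rw [inv_smul_eq_iff, D.sec_smul]
  have hadj : G.Adj (D.typ u) (b⁻¹ • v) := by
    have h := (D.act b⁻¹ u v).2 huv
    rwa [hut] at h
  have hv : b⁻¹ • v = D.sec (b⁻¹ • v) • D.typ (b⁻¹ • v) := (D.sec_smul _).symm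
  have hlip := D.lipN (D.typ u) (D.typ_mem u) (D.typ (b⁻¹ • v)) (D.typ_mem _) (D.sec (b⁻¹ • v)) (by rw [← hv]; exact hadj) i
  have hcv : D.chart v = D.ψ b + D.chart (b⁻¹ • v) := by
    conv_lhs => rw [← smul_inv_smul b v]
    rw [D.chart_smul]
  rw [hcv, Pi.add_apply, show D.chart u = D.ψ b from rfl, sub_add_cancel_left, abs_neg]
  exact hlip

/-- **Exact axis steps at every vertex**: a neighbour with chart `φ v + N σ eᵢ` (translate the representative's step). [folklore] -/
theorem step_at (D : OrbitDatum G A) (v : V) (i : Fin 2) (σ : ℤˣ) :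
    ∃ v' : V, G.Adj v v' ∧ D.chart v' = D.chart v + Pi.single i ((D.N : ℤ) * σ) := by
  obtain ⟨a, r', hr', hadj, hψ⟩ := D.step (D.typ v) (D.typ_mem v) i σ
  refine ⟨(D.sec v * a) • r', ?_, ?_⟩
  · have h := (D.act (D.sec v) _ _).2 hadj
    rwa [D.sec_smul, ← mul_smul] at h
  · rw [D.chart_smul_of_mem _ hr', D.ψ_mul, hψ]
    rfl

/-- Positive exact step at `v`. [folklore] -/
theorem step_pos (D : OrbitDatum G A) (v : V) (i : Fin 2) :
    ∃ v' : V, G.Adj v v' ∧ D.chart v' = D.chart v + Pi.single i (D.N : ℤ) := by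
  obtain ⟨v', h, e⟩ := D.step_at v i 1
  exact ⟨v', h, by rw [e, Units.val_one, mul_one]⟩

/-- Negative exact step at `v`. [folklore] -/
theorem step_neg (D : OrbitDatum G A) (v : V) (i : Fin 2) :
    ∃ v' : V, G.Adj v v' ∧ D.chart v' = D.chart v - Pi.single i (D.N : ℤ) := by
  obtain ⟨v', h, e⟩ := D.step_at v i (-1)
  exact ⟨v', h, by rw [e, Units.val_neg, Units.val_one, mul_neg, mul_one, Pi.single_neg, sub_eq_add_neg]⟩

/-! ### Walks inside chart boxes -/

/-- `u` and `v` are joined by a walk along which the chart stays in the box of radius `R` (about `0`, the common chart value of the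
representatives). [folklore] -/
def InBox (D : OrbitDatum G A) (R : ℕ) (u v : V) : Prop := ∃ w : G.Walk u v, ∀ z ∈ w.support, D.chart z ∈ box 2 R

/-- Transitivity of `InBox`. [folklore] -/
theorem inBox_trans (D : OrbitDatum G A) {R : ℕ} {u v w : V} (h₁ : D.InBox R u v) (h₂ : D.InBox R v w) : D.InBox R u w := by
  obtain ⟨w₁, hw₁⟩ := h₁
  obtain ⟨w₂, hw₂⟩ := h₂
  refine ⟨w₁.append w₂, fun z hz => ?_⟩
  rw [Walk.support_append, List.mem_append] at hz
  rcases hz with hz | hz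
  · exact hw₁ z hz
  · exact hw₂ z (List.tail_subset _ hz)

/-- Symmetry of `InBox`. [folklore] -/
theorem inBox_symm (D : OrbitDatum G A) {R : ℕ} {u v : V} (h : D.InBox R u v) : D.InBox R v u := by
  obtain ⟨w, hw⟩ := h
  exact ⟨w.reverse, fun z hz => hw z (by rwa [Walk.support_reverse, List.mem_reverse] at hz)⟩

/-- Monotonicity of `InBox` in the radius. [folklore] -/
theorem inBox_mono (D : OrbitDatum G A) {R R' : ℕ} (hR : R ≤ R') {u v : V} (h : D.InBox R u v) : D.InBox R' u v := by
  obtain ⟨w, hw⟩ := h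
  exact ⟨w, fun z hz => box_mono 2 hR (hw z hz)⟩

/-- The trivial boxed walk at a representative. [folklore] -/
theorem inBox_refl_of_mem (D : OrbitDatum G A) (R : ℕ) {r : V} (hr : r ∈ D.reps) : D.InBox R r r := by
  refine ⟨Walk.nil, fun z hz => ?_⟩
  rw [Walk.support_nil, List.mem_singleton] at hz
  subst hz
  rw [D.chart_of_mem hr]
  exact zero_mem_box 2 R

/-- The support of a translated walk is the translate of the support. [folklore] -/
theorem mem_support_map_smul (D : OrbitDatum G A) (a : A) {u v : V} (w : G.Walk u v) {z : V}
    (hz : z ∈ (w.map (smulIso D.act a).toHom).support) : ∃ z₀ ∈ w.support, a • z₀ = z := by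
  induction w with
  | nil =>
    rw [Walk.map_nil, Walk.support_nil, List.mem_singleton] at hz
    exact ⟨_, Walk.start_mem_support _, hz.symm⟩
  | cons h w ih =>
    rw [Walk.map_cons, Walk.support_cons, List.mem_cons] at hz
    rcases hz with hz | hz
    · exact ⟨_, Walk.start_mem_support _, hz.symm⟩
    · obtain ⟨z₀, hz₀, rfl⟩ := ih hz
      exact ⟨z₀, by rw [Walk.support_cons]; exact List.mem_cons_of_mem _ hz₀, rfl⟩

/-- **Translating a boxed walk**: by `a` with `‖ψ a‖_∞ ≤ S`, the box radius grows by `S`. [folklore] -/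
theorem inBox_smul (D : OrbitDatum G A) (a : A) {S : ℕ} (ha : ∀ i : Fin 2, |D.ψ a i| ≤ S) {R : ℕ} {u v : V} (h : D.InBox R u v) :
    D.InBox (S + R) (a • u) (a • v) := by
  obtain ⟨w, hw⟩ := h
  refine ⟨w.map (smulIso D.act a).toHom, fun z hz => ?_⟩
  obtain ⟨z₀, hz₀, rfl⟩ := D.mem_support_map_smul a w hz
  have hb := hw z₀ hz₀
  rw [mem_box] at hb ⊢
  intro i
  rw [D.chart_smul, Pi.add_apply]
  have h1 := hb i
  have h2 := ha i
  rw [abs_le] at h2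
  push_cast
  constructor <;> omega

/-- **Along a walk of length `ℓ` the chart moves by at most `N ℓ`** per coordinate. [folklore] -/
theorem chart_walk_bound (D : OrbitDatum G A) :
    ∀ {u v : V} (w : G.Walk u v), ∀ z ∈ w.support, ∀ i : Fin 2, |D.chart z i - D.chart u i| ≤ D.N * w.length
  | _, _, Walk.nil => by
    intro z hz i
    rw [Walk.support_nil, List.mem_singleton] at hz
    subst hz
    simp
  | u, _, Walk.cons (v := u') h w => by
    intro z hz i
    rw [Walk.support_cons, List.mem_cons] at hz
    rw [Walk.length_cons]
    rcases hz with rfl | hz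
    · simp
    · have ih := chart_walk_bound D w z hz i
      have hl := D.chart_lip h i
      rw [abs_le] at ih hl ⊢
      push_cast at ih ⊢
      constructor <;> nlinarith

/-- A vertex of `B(r, n)`, `r` a representative, is joined to `r` inside the box of radius `N n`. [folklore] -/
theorem inBox_of_mem_graphBall (D : OrbitDatum G A) {r : V} (hr : r ∈ D.reps) {v : V} {n : ℕ} (hv : v ∈ graphBall G r n) :
    D.InBox (D.N * n) r v := by
  obtain ⟨w, hw⟩ := hv
  refine ⟨w, fun z hz => ?_⟩
  rw [mem_box]
  intro i
  have h := D.chart_walk_bound w z hz i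
  rw [D.chart_of_mem hr, Pi.zero_apply, sub_zero, abs_le] at h
  have hmono : (D.N : ℤ) * w.length ≤ (D.N : ℤ) * n := by exact_mod_cast Nat.mul_le_mul_left D.N hw
  push_cast
  constructor <;> linarith [h.1, h.2]

/-- **Kernel walks**: every `k ∈ ker ψ` moves a representative `r` along a walk inside the box of radius `N m` (closure induction over the bounded kernel
generators at the base `r`; kernel translates do not move the chart). [cite: MilnorSolvableGrowth1968, Lemma 1] -/
theorem ker_inBox (D : OrbitDatum G A) {r : V} (hr : r ∈ D.reps) {k : A} (hk : D.ψ k = 0) : D.InBox (D.N * D.m) r (k • r) := by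
  have hmem := D.ker_gen r hr k hk
  suffices H : D.ψ k = 0 ∧ D.InBox (D.N * D.m) r (k • r) from H.2
  clear hk
  induction hmem using Subgroup.closure_induction with
  | mem g hg => exact ⟨hg.1, D.inBox_of_mem_graphBall hr hg.2⟩
  | one =>
    refine ⟨D.ψ_one, ?_⟩
    rw [one_smul]
    exact D.inBox_refl_of_mem _ hr
  | mul x y _ _ hx hy =>
    obtain ⟨hx0, hbx⟩ := hx
    obtain ⟨hy0, hby⟩ := hy
    refine ⟨by rw [D.ψ_mul, hx0, hy0, add_zero], ?_⟩
    have h2 := D.inBox_smul x (S := 0) (fun i => by rw [hx0, Pi.zero_apply, abs_zero]; rfl) hby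
    rw [Nat.zero_add] at h2
    rw [mul_smul]
    exact D.inBox_trans hbx h2
  | inv x _ hx =>
    obtain ⟨hx0, hbx⟩ := hx
    have hx0' : D.ψ x⁻¹ = 0 := by rw [D.ψ_inv, hx0, neg_zero]
    refine ⟨hx0', ?_⟩
    have h2 := D.inBox_smul x⁻¹ (S := 0) (fun i => by rw [hx0', Pi.zero_apply, abs_zero]; rfl) hbx
    rw [Nat.zero_add, inv_smul_smul] at h2
    exact D.inBox_symm h2

/-- A boxed walk of radius `R ≤ ℓ` is a walk of the cylinder of width `ℓ` at a representative. [folklore] -/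
theorem reach_of_inBox (D : OrbitDatum G A) {r : V} (hr : r ∈ D.reps) {ℓ R : ℕ} (hR : R ≤ ℓ) {u v : V} (h : D.InBox R u v)
    (hu : u ∈ {w | D.chart w - D.chart r ∈ box 2 ℓ}) (hv : v ∈ {w | D.chart w - D.chart r ∈ box 2 ℓ}) :
    (G.induce {w | D.chart w - D.chart r ∈ box 2 ℓ}).Reachable ⟨u, hu⟩ ⟨v, hv⟩ := by
  obtain ⟨w, hw⟩ := h
  have hw' : ∀ z ∈ w.support, z ∈ {w | D.chart w - D.chart r ∈ box 2 ℓ} := fun z hz => by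
    show D.chart z - D.chart r ∈ box 2 ℓ
    rw [D.chart_of_mem hr, sub_zero]
    exact box_mono 2 hR (hw z hz)
  exact ⟨w.induce _ hw'⟩

end OrbitDatum

end AutChart

end Summit.CriticalPhenomena.PercolationContinuityZ3.Theorems.Transplant

end
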